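import Mathlib
import Literature.Computability.Complexity.RandomKSatEnsembleOGP
import Summits.PneNP.PneNP.Theorems.OverlapGapAlgebraSearchHardWindowChainMassBasic
import Summits.PneNP.PneNP.Theorems.OverlapGapAlgebraSearchHardWindowResampleKernelBasic

/-!
# Route OverlapGapAlgebra, crux `SearchHardWindow` (stmt-PneNP-2460): total mass of the chain and
# weighted counts

For the `ε`-resampling Markov chain on a finite product space `V = ι → Γ` (Huang–Sellke 2025
§3.3.2; vocabulary `resampleKernel`, `resampleChainMass` of
`Literature/Computability/Complexity/RandomKSatEnsembleOGP.lean`) the mass of an event `E` on paths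
is the finite weighted count
`resampleChainMass ε K E = (Σ_y w(y) · [E (t ↦ y (min t K))]) / #V`,
`w(y) = ∏_{t<K} P_ε(y t, y (t+1))`, the sum ranging over `y : Fin (K+1) → V`.

`stub_chainMassTotal` records, for `0 ≤ ε ≤ 1`:
(a) the chain is a probability measure, `resampleChainMass ε K True = 1`: the kernel is stochastic
(`stub_resampleKernelBasic` (c) of `Theorems/OverlapGapAlgebraSearchHardWindowResampleKernelBasic.lean`),
so summing out the last vertex of a path (`Fin.snocEquiv`, `Fin.prod_univ_castSucc`) and inducting
on `K` gives `Σ_y w(y) = #V` (`cmt_pathSum_eq_card`), and `#V / #V = 1`;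
(b) weighted counts: if for every path `z` at most `M` indices `x : X` satisfy `E x z`, then
`Σ_x resampleChainMass ε K (E x) ≤ M` — after `Finset.sum_div`/`Finset.sum_comm`/`Finset.mul_sum`
this is `Σ_y w(y) · #{x | E x (path y)} ≤ Σ_y w(y) · M = M · #V` pathwise (`Finset.sum_boole`, the
weights being nonnegative by `cmb_pathWeight_nonneg` of
`Theorems/OverlapGapAlgebraSearchHardWindowChainMassBasic.lean`), divided by `#V`.
These feed the first-moment (chaos) step of line `Sketch`.
-/

set_option linter.dupNamespace false -- `Summit.PneNP.PneNP.…`: summit = sub-problem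

namespace Summit.PneNP.PneNP.Theorems

open Finset
open Literature.Computability.Complexity
open scoped Classical

/-- The `ε`-resampling kernel is stochastic for `0 ≤ ε ≤ 1`: `∑_{y'} P_ε(y, y') = 1`
(`stub_resampleKernelBasic` (c), restated through the `Literature` name `resampleKernel`). -/
theorem cmt_kernel_sum_eq_one {ι Γ : Type*} [Fintype ι] [DecidableEq ι] [Fintype Γ]
    [DecidableEq Γ] [Nonempty Γ] (ε : ℝ) (hε0 : 0 ≤ ε) (hε1 : ε ≤ 1) (y : ι → Γ) :
    ∑ y' : ι → Γ, resampleKernel ε y y' = 1 := by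
  have h := (stub_resampleKernelBasic (ι := ι) (Γ := Γ) ε hε0 hε1).2.2 y
  simpa only [resampleKernel] using h

/-- **Total mass of the paths of a stochastic kernel.** If every row of `P` sums to `1`, then
`Σ_{y : Fin (K+1) → S} ∏_{t<K} P (y t) (y (t+1)) = #S`: sum out the last vertex
(`Fin.snocEquiv`, `Fin.prod_univ_castSucc`) and induct on `K`. -/
theorem cmt_pathSum_eq_card {S : Type*} [Fintype S] (P : S → S → ℝ) (hP : ∀ a, ∑ b, P a b = 1) :
    ∀ K : ℕ, ∑ y : Fin (K + 1) → S, ∏ t : Fin K, P (y t.castSucc) (y t.succ) = Fintype.card S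
  | 0 => by simp
  | K + 1 => by
    calc ∑ y : Fin (K + 1 + 1) → S, ∏ t : Fin (K + 1), P (y t.castSucc) (y t.succ)
        = ∑ p : S × (Fin (K + 1) → S), ∏ t : Fin (K + 1),
            P ((Fin.snocEquiv fun _ => S) p t.castSucc) ((Fin.snocEquiv fun _ => S) p t.succ) :=
          ((Fin.snocEquiv fun _ : Fin (K + 1 + 1) => S).sum_comp _).symm
      _ = ∑ s : S, ∑ x : Fin (K + 1) → S,
            (∏ t : Fin K, P (x t.castSucc) (x t.succ)) * P (x (Fin.last K)) s := by
          rw [Fintype.sum_prod_type]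
          simp only [Fin.snocEquiv_apply, Fin.prod_univ_castSucc, Fin.succ_castSucc,
            Fin.snoc_castSucc, Fin.succ_last, Fin.snoc_last]
      _ = ∑ x : Fin (K + 1) → S,
            (∏ t : Fin K, P (x t.castSucc) (x t.succ)) * ∑ s, P (x (Fin.last K)) s := by
          rw [Finset.sum_comm]
          simp only [Finset.mul_sum]
      _ = Fintype.card S := by
          simp only [hP, mul_one]
          exact cmt_pathSum_eq_card P hP K

/-- **Total mass and weighted counts for the `ε`-resampling chain** (`0 ≤ ε ≤ 1`):
(a) `resampleChainMass ε K True = 1` (the kernel is stochastic, so the path weights sum to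
`#(ι → Γ)`), and (b) if for every path `z` at most `M` indices `x` of a finite type `X` satisfy
`E x z`, then `Σ_x resampleChainMass ε K (E x) ≤ M` (pathwise `Σ_x [E x z] = #{x | E x z} ≤ M`
against the nonnegative path weights, then (a)). -/
theorem stub_chainMassTotal {ι Γ : Type*} [Fintype ι] [DecidableEq ι] [Fintype Γ] [DecidableEq Γ]
    [Nonempty Γ] (ε : ℝ) (hε0 : 0 ≤ ε) (hε1 : ε ≤ 1) (K : ℕ) :
    resampleChainMass ε K (fun _ : ℕ → ι → Γ => True) = 1 ∧
    ∀ (X : Type) [Fintype X] (E : X → (ℕ → ι → Γ) → Prop) (M : ℝ),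
      (∀ z : ℕ → ι → Γ, ((univ.filter fun x : X => E x z).card : ℝ) ≤ M) →
      ∑ x : X, resampleChainMass ε K (E x) ≤ M := by
  have hcard : (Fintype.card (ι → Γ) : ℝ) ≠ 0 := by exact_mod_cast Fintype.card_ne_zero
  have hw : ∑ y : Fin (K + 1) → ι → Γ, ∏ t : Fin K, resampleKernel ε (y t.castSucc) (y t.succ) =
      Fintype.card (ι → Γ) :=
    cmt_pathSum_eq_card (resampleKernel ε) (cmt_kernel_sum_eq_one ε hε0 hε1) K
  refine ⟨?_, fun X _ E M hM => ?_⟩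
  · -- (a) total mass `1`
    unfold resampleChainMass
    simp only [if_true, mul_one]
    rw [hw, div_self hcard]
  · -- (b) weighted counts
    have hpt : ∀ y : Fin (K + 1) → ι → Γ,
        ∑ x : X, (∏ t : Fin K, resampleKernel ε (y t.castSucc) (y t.succ)) *
            (if E x (fun t => y ⟨min t K, Nat.lt_succ_of_le (Nat.min_le_right t K)⟩) then (1 : ℝ)
              else 0) ≤
          (∏ t : Fin K, resampleKernel ε (y t.castSucc) (y t.succ)) * M := fun y => by
      rw [← Finset.mul_sum, Finset.sum_boole]
      exact mul_le_mul_of_nonneg_left (hM _) (cmb_pathWeight_nonneg ε hε0 hε1 K y)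
    unfold resampleChainMass
    rw [← Finset.sum_div, Finset.sum_comm]
    calc _ ≤ (∑ y : Fin (K + 1) → ι → Γ,
            (∏ t : Fin K, resampleKernel ε (y t.castSucc) (y t.succ)) * M) / Fintype.card (ι → Γ) :=
          div_le_div_of_nonneg_right (Finset.sum_le_sum fun y _ => hpt y) (Nat.cast_nonneg _)
      _ = M := by rw [← Finset.sum_mul, hw, mul_div_cancel_left₀ M hcard]

end Summit.PneNP.PneNP.Theorems
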